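import Mathlib.Analysis.InnerProductSpace.PiL2
import Literature.MathematicalPhysics.StatisticalMechanics.Theil2006
import Literature.MathematicalPhysics.StatisticalMechanics.Theil2006Decay
import Literature.MathematicalPhysics.StatisticalMechanics.Theil2006MinimumDistance
import HarnessLib

/-!
# Theil 2006, Lemma 3.1: the minimum distance in minimizers of the relaxed periodic energy — proof

Topic `Literature/MathematicalPhysics/StatisticalMechanics`; companion of `Theil2006.lean` (the
model: `IsAdmissible`, `IsPeriodic`, `periodicEnergy`, `cellPoint`), `Theil2006Periodic.lean`
(Theorem 1.2) and `Theil2006MinimumDistance.lean` (Lemma 2.2, the finite-`N` minimum distance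
(13), whose cell-counting machinery is reused here). Everything in this file is PROVED (no `sorry`,
no named fact); the three definitions (`IsPeriodicSet`, `relaxedPeriodicEnergy`, `cellEquiv`) have
bodies.

## Source, as printed

F. Theil, *A proof of crystallization in two dimensions*, Comm. Math. Phys. **262** (2006)
209–236, §3 (read in the author's accepted preprint of 26 Aug 2005, same numbering, p. 13):

"Let `L ∈ ℕ`; a set `X ⊂ A₂` is `L`-periodic if `X + L A₂ = X`. […] We say that a map
`y : X → ℝ²` is `L`-periodic if `y(x + τ) = y(x) + τ` for all `x ∈ X` and all `τ ∈ L A₂`. […] The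
proof of Theorem 1.1 is hinged on the lower bound on the inter-particle distance (13). The proof of
(13) is based on a construction where those particles that are too close to each other are moved to
infinity and thereby effecively removed from the system without increasing the energy. As the
definition of `E_L^per` doesn't allow removal of particles we have to relax the minimization
problem slightly in order to rescue (13). This is achieved by removing `L`-periodic subsets from
`A₂`: If `X ⊂ A₂` is `L`-periodic we set `E_L^per(X, {y}) := ∑_{{p ⊂ X | #p = 2}/∼} e(p)`. Clearly
`E_L^per(X, ·) = E_L^per(·)` (defined in Theorem 1.2) if `X = A₂`. Furthermore, since there are only
`2^{L²}` possible `L`-periodic sets `X`, a minimizer `(X_min, y_min)` of `E_L^per` exists. Due to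
the more complicated mechanism of particle-removal we have to establish a new version of Lemma 2.2.

**Lemma 3.1.** There exists `α₀ ∈ (0, ½)` such that for all `α ∈ (0, α₀)`, `L ∈ ℕ` and all
minimizers `(X_min, y_min)` of `E_L^per(·, ·)` the minimum distance between the particles
satisfies estimate (13)." [(13): `min_{x ≠ x'} |y(x) - y(x')| > 1 - α`.]

Printed proof (p. 13–14): "It can be assumed wlog that `L ≥ 4` […]. Let `M` and `𝒜` be defined
as in the proof of Lemma 2.2. In the periodic situation we have to take the interaction between the
particles in `𝒜` and the mirror images into account. The decay estimate (5) implies that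
`∑_{x ∈ 𝒜} ∑_{x' ∈ (𝒜 + LA₂)∖𝒜} e({x,x'}) ≥ -C M² α` […]. We replace (14) by the estimate
`∑_{x ∈ 𝒜} ∑_{x' ∈ X∖(𝒜+LA₂)} e({x,x'}) ≤ -M(M-1)/(2α) + C M² α` and (17) by
`-C M² (∑_{k=2}^{8} 2k + α ∑_{k ≥ 9} ((1-α)(k-1)/2)⁻⁵) ≤ -M(M-1)/(2α) + C M² α`. Repeating the
reasoning at the end of the proof of Lemma 2.2 we obtain that `M = 1` if `α` is sufficiently small,
the only difference is that one additional term on the right-hand side is created by periodicity."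

## What is here

* `Theil2006.IsPeriodicSet L X` — `X + L A₂ = X` for a set of labels `X ⊆ ℤ² ≅ A₂`.
* `Theil2006.relaxedPeriodicEnergy V L X y` — `E_L^per(X, {y})`, rendered like `periodicEnergy`
  (`E_L^per` of Theorem 1.2) in the ORDERED form `∑_{x ∈ X ∩ LU} ∑_{x' ∈ X∖{x}} V(|y(x) - y(x')|)`
  (every particle of one period cell interacts with all other particles of `X`; configurations
  `y ∈ Y_L^per` are maps on all of `A₂`, only `y|_X` enters). This meets every class of pairs
  `{x, x'} ⊂ X` modulo `L A₂` exactly twice, so it is twice the printed class sum; the printed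
  sentence "Clearly `E_L^per(X, ·) = E_L^per(·)` if `X = A₂`" holds literally in this form
  (`relaxedPeriodicEnergy_univ`), and the minimizers — all that Lemma 3.1 speaks about — are the
  same under either normalisation. A periodic map on `X` extends to one on `A₂`, so minimizing over
  pairs (`L`-periodic `X`, `y ∈ Y_L^per`) is the printed minimization.
* `Theil2006.periodicMinimumDistance` — **Lemma 3.1 as printed**, PROVED, in the `∃ α₀ ∈ (0, ½)`
  form; `Theil2006.lt_dist_of_isMinimizer_relaxedPeriodicEnergy` — the same with the explicit
  threshold `α₀ = 1/13447168` of `Theil2006_minimumDistance_holds` (Theil does not optimise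
  constants, p. 4). `L ≥ 1` (`L ∈ ℕ = {1, 2, …}` in the paper; `L = 0` is meaningless).
* Infrastructure for periodic configurations, reusable for (44) and the end of the proof of
  Theorem 1.2: the period-cell decomposition `cellEquiv : (A₂ ∩ LU) × ℤ² ≃ A₂`, `(x, g) ↦ x + Lg`;
  `IsPeriodic.apply_add_zsmul` (`y(x + Lg) = y(x) + L ξ_g`); local finiteness
  `IsPeriodic.finite_dist_le`; convergence of the row sums `IsAdmissible.summable_periodic` (so the
  `tsum`s in `relaxedPeriodicEnergy`/`periodicEnergy` are genuine sums for admissible `V`); the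
  coset decomposition of sums over periodic sets `IsPeriodicSet.tsum_eq_sum_tsum`; and the
  symmetry of mixed periodic double sums `IsPeriodic.sum_tsum_comm`.

## Proof architecture (the printed argument; bookkeeping as in `Theil2006MinimumDistance.lean`)

`M` := the maximal number of particles of `X` in a closed disc of radius `ρ = (1-α)/2` (finite by
local finiteness, `≤ L²` because two particles of one coset `x + L A₂` are `≥ L ≥ 1 > 2ρ` apart),
attained at `η₀`; `𝒜 := X ∩ y⁻¹ B(η₀, ρ)` (`#𝒜 = M`); a pair at distance `≤ 1 - α` forces `M ≥ 2`.
The competitor removes `P := 𝒜 + L A₂` (periodic, `⊆ X`) and keeps `y`. In the ordered form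
`E(X) - E(X∖P) = ∑_{x ∈ (X∖P)∩LU} ∑_{x' ∈ P} e + ∑_{x ∈ P∩LU} ∑_{x' ∈ X∖P} e + ∑_{x ∈ P∩LU}
∑_{x' ∈ P∖{x}} e`, the first two sums being equal (`IsPeriodic.sum_tsum_comm`: both enumerate the
pair classes between `P` and `X ∖ P` once). `P ∩ LU` consists of exactly `M` points `x = a + Lg`,
`a ∈ 𝒜`, each in the translated maximal disc `B(η₀ + Lξ_g, ρ) ⊇ y(𝒜 + Lg)`: its `M - 1`
companions are at distance `≤ 1 - α` and cost `≥ 1/α` each by (2), while EVERY row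
`∑_{x' ∈ T} e({x, x'})`, `T ⊆ X`, is `≥ -W M` (`W = 4 K₀`, `K₀ = 420224`): each term is
`≥ -K₀ w(cell of y(x'))` (`IsAdmissible.neg_cellWeight_le` of the Lemma 2.2 file: (11) `V ≥ -134`
in the near cells, the decay (12) in the far ones — this is where the mirror images
`(𝒜 + L A₂) ∖ 𝒜` and Theil's `-C M² α` are absorbed), each cell holds `≤ M` particles of `X`, and
the weights have partial sums `≤ 4` (`sum_cellWeight_le_finset`, `sum_prod_inv_natAbs_le_four`).
Minimality of `(X, y)` then gives `0 ≥ M(M-1)/α - 3 W M²`, impossible for `M ≥ 2`, `α < 1/(6W)`.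
Deviation from the print: summable cell weights replace the ring counts `n(k) ≤ C M k` of
(15)–(17) (as in the Lemma 2.2 file), and the reduction "wlog `L ≥ 4`" is not needed.
-/

noncomputable section

open scoped BigOperators Topology
open Filter Set Metric

namespace Literature.MathematicalPhysics.StatisticalMechanics

namespace Theil2006

/-! ### `L`-periodic label sets and the relaxed periodic energy (§3, p. 13) -/

/-- **`L`-periodic sets of particles** (Theil 2006, §3, p. 13: "Let `L ∈ ℕ`; a set `X ⊂ A₂` is
`L`-periodic if `X + L A₂ = X`"), in labels: `k ∈ X ⇒ k + L g ∈ X` for every `g ∈ ℤ²` (hence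
`⇔`, `IsPeriodicSet.add_zsmul_mem_iff`). [cite: Theil2006, §3 (preprint p. 13)] -/
def IsPeriodicSet (L : ℕ) (X : Set (ℤ × ℤ)) : Prop :=
  ∀ k ∈ X, ∀ g : ℤ × ℤ, k + (L : ℤ) • g ∈ X

/-- **The relaxed periodic energy `E_L^per(X, {y})`** of Theil 2006, §3, p. 13 ("As the
definition of `E_L^per` doesn't allow removal of particles we have to relax the minimization
problem slightly in order to rescue (13). This is achieved by removing `L`-periodic subsets from
`A₂`: If `X ⊂ A₂` is `L`-periodic we set `E_L^per(X, {y}) := ∑_{{p ⊂ X | #p = 2}/∼} e(p)`",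
`e({x,x'}) = V(|y(x) - y(x')|)`, `∼` = translation by `L A₂`), written — exactly like
`periodicEnergy` (`= E_L^per` of Theorem 1.2) — in the ordered form: every particle `x ∈ X` of the
period cell `A₂ ∩ LU` interacts with all other particles of `X`,
`∑_{x ∈ X ∩ LU} ∑_{x' ∈ X ∖ {x}} V(|y(x) - y(x')|)`. (Each class of pairs is met twice, once from
each end, so this is twice the printed class sum — the same convention as `periodicEnergy`, cf.
p. 13 "Clearly `E_L^per(X, ·) = E_L^per(·)` (defined in Theorem 1.2) if `X = A₂`":
`relaxedPeriodicEnergy_univ`; minimizers are the same.) The inner sums are `tsum`s, genuine sums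
for admissible `V` and periodic `y` (`IsAdmissible.summable_periodic`).
[cite: Theil2006, §3 (preprint p. 13)] -/
def relaxedPeriodicEnergy (V : ℝ → ℝ) (L : ℕ) (X : Set (ℤ × ℤ)) (y : ℤ × ℤ → Plane) : ℝ :=
  ∑ c : Fin L × Fin L,
    X.indicator (fun k => ∑' k' : {k' : ℤ × ℤ // k' ∈ X ∧ k' ≠ k}, V (dist (y k) (y k'.1)))
      (cellPoint c)

section PeriodicSets

variable {L : ℕ} {X P : Set (ℤ × ℤ)}

/-- `X + L A₂ = X`: membership is invariant under the period lattice. [cite: Theil2006, §3 (preprint p. 13)] -/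
theorem IsPeriodicSet.add_zsmul_mem_iff (hX : IsPeriodicSet L X) (k g : ℤ × ℤ) :
    k + (L : ℤ) • g ∈ X ↔ k ∈ X := by
  refine ⟨fun h => ?_, fun h => hX k h g⟩
  have := hX _ h (-g)
  rwa [smul_neg, add_neg_cancel_right] at this

/-- `A₂` itself is `L`-periodic (the case `X = A₂` of p. 13, "Clearly `E_L^per(X, ·) = E_L^per(·)`
… if `X = A₂`"). [cite: Theil2006, §3 (preprint p. 13)] -/
theorem isPeriodicSet_univ (L : ℕ) : IsPeriodicSet L (univ : Set (ℤ × ℤ)) :=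
  fun _ _ _ => mem_univ _

/-- Removing an `L`-periodic subset from an `L`-periodic set leaves an `L`-periodic set (the
competitors of §3). [cite: Theil2006, §3 (preprint p. 13)] -/
theorem IsPeriodicSet.diff (hX : IsPeriodicSet L X) (hP : IsPeriodicSet L P) :
    IsPeriodicSet L (X \ P) := fun k hk g =>
  ⟨hX k hk.1 g, fun h => hk.2 ((hP.add_zsmul_mem_iff k g).1 h)⟩

/-- With `X = A₂` the relaxed energy is the periodic energy `E_L^per` of Theorem 1.2 (p. 13:
"Clearly `E_L^per(X, ·) = E_L^per(·)` … if `X = A₂`"). [cite: Theil2006, §3 (preprint p. 13)] -/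
theorem relaxedPeriodicEnergy_univ (V : ℝ → ℝ) (L : ℕ) (y : ℤ × ℤ → Plane) :
    relaxedPeriodicEnergy V L univ y = periodicEnergy V L y := by
  unfold relaxedPeriodicEnergy periodicEnergy
  refine Finset.sum_congr rfl fun c _ => ?_
  rw [indicator_of_mem (mem_univ _)]
  exact tsum_congr_set_coe (fun k' => V (dist (y (cellPoint c)) (y k'))) (by ext; simp)

end PeriodicSets

/-! ### The period cell: labels `k = x + L g`, `x ∈ A₂ ∩ LU`, `g ∈ ℤ²` -/

section Cell

variable {L : ℕ}

/-- The coordinates of a cell representative lie in `[0, L)`. [folklore] -/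
private theorem cellPoint_fst_nonneg (c : Fin L × Fin L) : 0 ≤ (cellPoint c).1 := by
  simp [cellPoint]

/-- The coordinates of a cell representative lie in `[0, L)`. [folklore] -/
private theorem cellPoint_snd_nonneg (c : Fin L × Fin L) : 0 ≤ (cellPoint c).2 := by
  simp [cellPoint]

/-- The coordinates of a cell representative lie in `[0, L)`. [folklore] -/
private theorem cellPoint_fst_lt (c : Fin L × Fin L) : (cellPoint c).1 < L := by
  simp only [cellPoint]; exact_mod_cast c.1.2

/-- The coordinates of a cell representative lie in `[0, L)`. [folklore] -/
private theorem cellPoint_snd_lt (c : Fin L × Fin L) : (cellPoint c).2 < L := by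
  simp only [cellPoint]; exact_mod_cast c.2.2

/-- `(x, g) ↦ x + L g` is injective on `(A₂ ∩ LU) × ℤ²`. [folklore] -/
private theorem cellPoint_add_zsmul_injective (hL : 0 < L) :
    Function.Injective fun q : (Fin L × Fin L) × (ℤ × ℤ) => cellPoint q.1 + (L : ℤ) • q.2 := by
  rintro ⟨c, g⟩ ⟨c', g'⟩ h
  simp only [Prod.ext_iff, Prod.fst_add, Prod.snd_add, Prod.smul_fst, Prod.smul_snd,
    smul_eq_mul] at h
  obtain ⟨h1, h2⟩ := h
  have a1 := cellPoint_fst_nonneg c; have a2 := cellPoint_fst_lt c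
  have b1 := cellPoint_fst_nonneg c'; have b2 := cellPoint_fst_lt c'
  have a3 := cellPoint_snd_nonneg c; have a4 := cellPoint_snd_lt c
  have b3 := cellPoint_snd_nonneg c'; have b4 := cellPoint_snd_lt c'
  have hL' : (0 : ℤ) < L := by exact_mod_cast hL
  have hg1 : g.1 = g'.1 := by
    by_contra hne
    rcases lt_or_gt_of_ne hne with h | h
    · have : (L : ℤ) * g.1 + L ≤ L * g'.1 := by nlinarith
      nlinarith
    · have : (L : ℤ) * g'.1 + L ≤ L * g.1 := by nlinarith
      nlinarith
  have hg2 : g.2 = g'.2 := by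
    by_contra hne
    rcases lt_or_gt_of_ne hne with h | h
    · have : (L : ℤ) * g.2 + L ≤ L * g'.2 := by nlinarith
      nlinarith
    · have : (L : ℤ) * g'.2 + L ≤ L * g.2 := by nlinarith
      nlinarith
  have hc1 : (cellPoint c).1 = (cellPoint c').1 := by rw [hg1] at h1; linarith
  have hc2 : (cellPoint c).2 = (cellPoint c').2 := by rw [hg2] at h2; linarith
  simp only [cellPoint, Nat.cast_inj] at hc1 hc2
  exact Prod.ext (Prod.ext (Fin.ext hc1) (Fin.ext hc2)) (Prod.ext hg1 hg2)

/-- Every label is `x + L g` with `x` in the period cell. [folklore] -/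
private theorem cellPoint_add_zsmul_surjective (hL : 0 < L) :
    Function.Surjective fun q : (Fin L × Fin L) × (ℤ × ℤ) => cellPoint q.1 + (L : ℤ) • q.2 := by
  intro k
  have hL' : (0 : ℤ) < L := by exact_mod_cast hL
  have h1 := Int.emod_nonneg k.1 hL'.ne'
  have h2 := Int.emod_nonneg k.2 hL'.ne'
  have h3 := Int.emod_lt_of_pos k.1 hL'
  have h4 := Int.emod_lt_of_pos k.2 hL'
  refine ⟨((⟨(k.1 % L).toNat, by omega⟩, ⟨(k.2 % L).toNat, by omega⟩), (k.1 / L, k.2 / L)), ?_⟩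
  ext
  · simp only [cellPoint, Prod.fst_add, Prod.smul_fst, smul_eq_mul]
    rw [Int.toNat_of_nonneg h1]
    linarith [Int.emod_add_mul_ediv k.1 (L : ℤ)]
  · simp only [cellPoint, Prod.snd_add, Prod.smul_snd, smul_eq_mul]
    rw [Int.toNat_of_nonneg h2]
    linarith [Int.emod_add_mul_ediv k.2 (L : ℤ)]

/-- **The period cell decomposition** `A₂ = ⨆_{x ∈ A₂ ∩ LU} (x + L A₂)`: labels correspond to
pairs (cell representative, period vector), `(x, g) ↦ x + L g` — the identification of
`A₂ mod L A₂` with `A₂ ∩ LU` of Theil 2006, p. 2, made a bijection.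
[cite: Theil2006, §1 («we identify … the quotient space A₂ mod LA₂ with the representatives A₂ ∩ LU», preprint p. 2)] -/
def cellEquiv (hL : 0 < L) : (Fin L × Fin L) × (ℤ × ℤ) ≃ ℤ × ℤ :=
  Equiv.ofBijective (fun q => cellPoint q.1 + (L : ℤ) • q.2)
    ⟨cellPoint_add_zsmul_injective hL, cellPoint_add_zsmul_surjective hL⟩

/-- `cellEquiv (x, g) = x + L g`.
[cite: Theil2006, §1 («we identify … the quotient space A₂ mod LA₂ with the representatives A₂ ∩ LU», preprint p. 2)] -/
@[simp] theorem cellEquiv_apply (hL : 0 < L) (q : (Fin L × Fin L) × (ℤ × ℤ)) :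
    cellEquiv hL q = cellPoint q.1 + (L : ℤ) • q.2 := rfl

/-- Every label is its cell representative plus `L` times its period vector.
[cite: Theil2006, §1 («we identify … the quotient space A₂ mod LA₂ with the representatives A₂ ∩ LU», preprint p. 2)] -/
theorem cellEquiv_symm_apply_spec (hL : 0 < L) (k : ℤ × ℤ) :
    cellPoint ((cellEquiv hL).symm k).1 + (L : ℤ) • ((cellEquiv hL).symm k).2 = k :=
  (cellEquiv hL).apply_symm_apply k

/-- `triPoint (L g) = L · triPoint g`. [folklore] -/
private theorem triPoint_zsmul (L : ℕ) (g : ℤ × ℤ) : triPoint ((L : ℤ) • g) = (L : ℝ) • triPoint g := by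
  rw [map_zsmul, ← Int.cast_smul_eq_zsmul ℝ, Int.cast_natCast]

/-- A periodic configuration along a coset of the period lattice: `y(x + L g) = y(x) + L ξ_g`
(`Y_L^per`). [cite: Theil2006, §1 Theorem 1.2 (`Y_L^per`, preprint p. 3)] -/
theorem IsPeriodic.apply_add_zsmul {y : ℤ × ℤ → Plane} (hy : IsPeriodic L y) (k g : ℤ × ℤ) :
    y (k + (L : ℤ) • g) = y k + (L : ℝ) • triPoint g := by
  rw [hy k g, triPoint_zsmul]

/-- Distinct points of one coset `x + L A₂` of a periodic configuration (`L ≥ 1`) are at distance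
`≥ L ≥ 1`. [cite: Theil2006, §1 Theorem 1.2 (`Y_L^per`, preprint p. 3); our lemma] -/
theorem IsPeriodic.one_le_dist_add_zsmul (hL : 0 < L) {y : ℤ × ℤ → Plane} (hy : IsPeriodic L y)
    (k : ℤ × ℤ) {g : ℤ × ℤ} (hg : g ≠ 0) : 1 ≤ dist (y k) (y (k + (L : ℤ) • g)) := by
  rw [hy.apply_add_zsmul, dist_eq_norm, sub_add_cancel_left, norm_neg, norm_smul,
    Real.norm_natCast]
  have h1 := one_le_norm_triPoint hg
  have hL1 : (1 : ℝ) ≤ L := by exact_mod_cast hL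
  nlinarith

end Cell

/-! ### Local finiteness and summability for periodic configurations -/

section Finiteness

variable {L : ℕ} {y : ℤ × ℤ → Plane}

/-- Labels of `A₂` with `|ξ| ≤ R` form a finite set. [folklore] -/
private theorem finite_norm_triPoint_le (R : ℝ) : {g : ℤ × ℤ | ‖triPoint g‖ ≤ R}.Finite := by
  have h := (tendsto_norm_triPoint_cofinite.eventually_gt_atTop R)
  simp only [Filter.eventually_cofinite, not_lt] at h
  exact h

/-- **Periodic configurations are locally finite** (`L ≥ 1`): only finitely many particles lie in
any disc (so the particle counts `#(y(X) ∩ B(η, ½(1-α)))` of the proofs of Lemmas 2.2/3.1 are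
finite in the periodic setting). [cite: Theil2006, §1 Theorem 1.2 (`Y_L^per`, preprint p. 3); our lemma] -/
theorem IsPeriodic.finite_dist_le (hL : 0 < L) (hy : IsPeriodic L y) (p : Plane) (R : ℝ) :
    {k : ℤ × ℤ | dist (y k) p ≤ R}.Finite := by
  classical
  set B : ℝ := ∑ c : Fin L × Fin L, dist (y (cellPoint c)) p with hB
  have hBc : ∀ c, dist (y (cellPoint c)) p ≤ B := fun c => by
    rw [hB]
    exact Finset.single_le_sum (f := fun c => dist (y (cellPoint c)) p) (fun c _ => dist_nonneg)
      (Finset.mem_univ c)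
  have hS := finite_norm_triPoint_le (R + B)
  refine ((Set.finite_univ.prod hS).image (cellEquiv hL)).subset fun k hk => ?_
  rw [Set.mem_setOf_eq] at hk
  refine ⟨(cellEquiv hL).symm k, ⟨mem_univ _, ?_⟩, (cellEquiv hL).apply_symm_apply k⟩
  set c := ((cellEquiv hL).symm k).1
  set g := ((cellEquiv hL).symm k).2
  have hk' : k = cellPoint c + (L : ℤ) • g := (cellEquiv_symm_apply_spec hL k).symm
  have hyk : y k = y (cellPoint c) + (L : ℝ) • triPoint g := by rw [hk', hy.apply_add_zsmul]
  rw [Set.mem_setOf_eq]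
  have h1 : ‖(L : ℝ) • triPoint g‖ ≤ R + B := by
    have e : (L : ℝ) • triPoint g = y k - y (cellPoint c) := by rw [hyk]; abel
    rw [e, ← dist_eq_norm]
    linarith [dist_triangle (y k) p (y (cellPoint c)), dist_comm p (y (cellPoint c)), hBc c]
  rw [norm_smul, Real.norm_natCast] at h1
  have hL1 : (1 : ℝ) ≤ L := by exact_mod_cast hL
  nlinarith [norm_nonneg (triPoint g)]

end Finiteness

section Summability

variable {α : ℝ} {V : ℝ → ℝ} {L : ℕ} {y : ℤ × ℤ → Plane}

/-- For an admissible potential, `g ↦ V(|q - L ξ_g|)` is summable over `A₂` for every `q ∈ ℝ²`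
and `L ≥ 1` (decay (12) against the lattice `p`-series). [folklore] -/
private theorem IsAdmissible.summable_norm_sub_smul (hV : IsAdmissible α V) (hL : 0 < L) (q : Plane) :
    Summable fun g : ℤ × ℤ => V ‖q - (L : ℝ) • triPoint g‖ := by
  have hL1 : (1 : ℝ) ≤ L := by exact_mod_cast hL
  have hL0 : (0 : ℝ) < L := by linarith
  set q' : Plane := (L : ℝ)⁻¹ • q with hq'
  have hscale : ∀ g, ‖q - (L : ℝ) • triPoint g‖ = L * ‖q' - triPoint g‖ := fun g => by
    have e : q - (L : ℝ) • triPoint g = (L : ℝ) • (q' - triPoint g) := by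
      rw [hq', smul_sub, smul_inv_smul₀ hL0.ne']
    rw [e, norm_smul, Real.norm_natCast]
  refine Summable.of_norm_bounded_eventually
    ((summable_norm_triPoint_sub_rpow q' (by norm_num : (-5 : ℝ) < -2)).mul_left (α / 30)) ?_
  filter_upwards [(tendsto_norm_sub_triPoint_cofinite q').eventually_ge_atTop (4 / 3)] with g hg
  rw [Real.norm_eq_abs, hscale]
  have h43 : 4 / 3 ≤ (L : ℝ) * ‖q' - triPoint g‖ := by nlinarith [norm_nonneg (q' - triPoint g)]
  refine (hV.abs_apply_le h43).trans ?_
  have hα := hV.alpha_nonneg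
  have h0 : 0 < ‖q' - triPoint g‖ := by linarith
  rw [Real.rpow_neg (norm_nonneg _), norm_sub_rev (triPoint g) q', inv_pow]
  have e5 : ‖q' - triPoint g‖ ^ (5 : ℝ) = ‖q' - triPoint g‖ ^ 5 := by norm_cast
  rw [e5]
  have h1 : ‖q' - triPoint g‖ ^ 5 ≤ ((L : ℝ) * ‖q' - triPoint g‖) ^ 5 := by
    apply pow_le_pow_left₀ h0.le; nlinarith
  have h2 : (((L : ℝ) * ‖q' - triPoint g‖) ^ 5)⁻¹ ≤ (‖q' - triPoint g‖ ^ 5)⁻¹ :=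
    inv_anti₀ (by positivity) h1
  exact mul_le_mul_of_nonneg_left h2 (by positivity)

/-- Summability over a product with a finite first factor, slice by slice. [folklore] -/
private theorem summable_prod_of_finite_fst {ι β : Type*} [Fintype ι] [DecidableEq ι] {f : ι × β → ℝ}
    (hf : ∀ i, Summable fun b => f (i, b)) : Summable f := by
  have hpiece : ∀ i, Summable fun q : ι × β => if q.1 = i then f q else 0 := by
    intro i
    have hinj : Function.Injective fun b : β => (i, b) := Prod.mk_right_injective i
    have h0 : ∀ q ∉ Set.range (fun b : β => (i, b)), (if q.1 = i then f q else 0) = 0 := by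
      rintro ⟨i', b⟩ hq
      rw [if_neg]
      rintro rfl
      exact hq ⟨b, rfl⟩
    refine (hinj.summable_iff h0).1 ?_
    simpa [Function.comp_def] using hf i
  have hsum := summable_sum (s := Finset.univ) fun i _ => hpiece i
  refine hsum.congr fun q => ?_
  simp only [Finset.sum_ite_eq, Finset.mem_univ, if_true]

/-- **Row sums of periodic configurations converge.** For admissible `V`, `L ≥ 1` and
`y ∈ Y_L^per`, `x' ↦ V(|p - y(x')|)` is summable over all labels (so the inner sums of
`relaxedPeriodicEnergy` / `periodicEnergy` are genuine): `y(A₂)` is the union of the `L²`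
translated lattices `y(x) + L A₂`.
[cite: Theil2006, §1 Theorem 1.2 (`E_L^per`, preprint p. 3) and §3 (`E_L^per(X, {y})`, p. 13); our lemma] -/
theorem IsAdmissible.summable_periodic (hV : IsAdmissible α V) (hL : 0 < L) (hy : IsPeriodic L y)
    (p : Plane) : Summable fun k : ℤ × ℤ => V (dist p (y k)) := by
  classical
  rw [← (cellEquiv hL).summable_iff]
  refine summable_prod_of_finite_fst fun c => ?_
  have e : ∀ g : ℤ × ℤ, ((fun k => V (dist p (y k))) ∘ cellEquiv hL) (c, g) =
      V ‖(p - y (cellPoint c)) - (L : ℝ) • triPoint g‖ := fun g => by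
    simp only [Function.comp_apply, cellEquiv_apply, hy.apply_add_zsmul, dist_eq_norm]
    congr 1
    abel_nf
  simp_rw [e]
  exact hV.summable_norm_sub_smul hL _

end Summability

/-! ### Sums over periodic sets, coset by coset -/

section Cosets

variable {L : ℕ} {T : Set (ℤ × ℤ)}

/-- The residue of `x + L g` (`x` in the period cell) is `x`.
[cite: Theil2006, §1 («we identify … the quotient space A₂ mod LA₂ with the representatives A₂ ∩ LU», preprint p. 2)] -/
theorem cellEquiv_symm_cellPoint_add (hL : 0 < L) (c : Fin L × Fin L) (g : ℤ × ℤ) :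
    (cellEquiv hL).symm (cellPoint c + (L : ℤ) • g) = (c, g) :=
  (cellEquiv hL).symm_apply_apply (c, g)

/-- Membership in an `L`-periodic set only depends on the residue modulo `L A₂` (the quotient
set `X̃ = X/∼` of p. 13). [cite: Theil2006, §3 (quotient sets `X̃ := X/∼`, preprint p. 13)] -/
theorem IsPeriodicSet.mem_iff_cellPoint_mem (hL : 0 < L) (hT : IsPeriodicSet L T) (k : ℤ × ℤ) :
    k ∈ T ↔ cellPoint ((cellEquiv hL).symm k).1 ∈ T := by
  conv_lhs => rw [← cellEquiv_symm_apply_spec hL k]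
  exact hT.add_zsmul_mem_iff _ _

/-- `g ↦ x + L g` is injective (`L ≥ 1`). [folklore] -/
private theorem cellPoint_add_zsmul_injective_right (hL : 0 < L) (c : Fin L × Fin L) :
    Function.Injective fun g : ℤ × ℤ => cellPoint c + (L : ℤ) • g := fun g g' h =>
  (Prod.ext_iff.1 (cellPoint_add_zsmul_injective hL (a₁ := (c, g)) (a₂ := (c, g')) h)).2

/-- An `L`-periodic set is the disjoint union of the cosets `x + L A₂` of its cell
representatives `x ∈ T ∩ LU` (the quotient set `T̃ = T/∼` of p. 13, realised by representatives).
[cite: Theil2006, §3 (quotient sets `X̃ := X/∼`, preprint p. 13)] -/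
theorem IsPeriodicSet.eq_biUnion_range (hL : 0 < L) (hT : IsPeriodicSet L T)
    (s : Finset (Fin L × Fin L)) (hs : ∀ c, c ∈ s ↔ cellPoint c ∈ T) :
    T = ⋃ c ∈ s, Set.range fun g : ℤ × ℤ => cellPoint c + (L : ℤ) • g := by
  ext k
  rw [Set.mem_iUnion₂]
  constructor
  · intro hk
    exact ⟨((cellEquiv hL).symm k).1, (hs _).2 ((hT.mem_iff_cellPoint_mem hL k).1 hk),
      ((cellEquiv hL).symm k).2, cellEquiv_symm_apply_spec hL k⟩
  · rintro ⟨c, hc, g, rfl⟩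
    exact hT _ ((hs c).1 hc) g

/-- Distinct cell representatives have disjoint cosets. [folklore] -/
private theorem pairwiseDisjoint_range_cellPoint_add (hL : 0 < L) (s : Finset (Fin L × Fin L)) :
    (s : Set (Fin L × Fin L)).Pairwise
      (Function.onFun Disjoint fun c => Set.range fun g : ℤ × ℤ => cellPoint c + (L : ℤ) • g) := by
  intro c _ c' _ hcc'
  refine Set.disjoint_left.2 ?_
  rintro k ⟨g, rfl⟩ ⟨g', hg'⟩
  have h := cellPoint_add_zsmul_injective hL (a₁ := (c', g')) (a₂ := (c, g)) hg'
  exact hcc' (Prod.ext_iff.1 h).1.symm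

/-- **Summing over an `L`-periodic set coset by coset**: for a summable `φ`,
`∑_{x' ∈ T} φ(x') = ∑_{x ∈ T ∩ LU} ∑_{g ∈ ℤ²} φ(x + L g)` (p. 14: "replacing the sets `X`, `∂X`, `𝒮`,
`𝒯_λ` with the corresponding quotient sets … and the elements of those quotient sets by
representatives"). [cite: Theil2006, §3 (preprint pp. 13–14); our lemma] -/
theorem IsPeriodicSet.tsum_eq_sum_tsum (hL : 0 < L) (hT : IsPeriodicSet L T)
    (s : Finset (Fin L × Fin L)) (hs : ∀ c, c ∈ s ↔ cellPoint c ∈ T) {φ : ℤ × ℤ → ℝ}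
    (hφ : Summable φ) :
    ∑' k : T, φ k = ∑ c ∈ s, ∑' g : ℤ × ℤ, φ (cellPoint c + (L : ℤ) • g) := by
  rw [tsum_congr_set_coe φ (hT.eq_biUnion_range hL s hs),
    Summable.tsum_finset_bUnion_disjoint (pairwiseDisjoint_range_cellPoint_add hL s)
      fun c _ => hφ.subtype _]
  exact Finset.sum_congr rfl fun c _ => tsum_range φ (cellPoint_add_zsmul_injective_right hL c)

/-- **Symmetry of the interaction between two periodic families.** For `L`-periodic label sets
`S, T`, a configuration `y ∈ Y_L^per` and a radial pair interaction `W` with summable rows, the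
interaction of the cell representatives of `S` with all of `T` equals the interaction of the cell
representatives of `T` with all of `S` (both count every class of pairs `{x, x'}`, `x ∈ S`,
`x' ∈ T`, modulo `L A₂` exactly once). [cite: Theil2006, §3 (preprint p. 13); our lemma] -/
theorem IsPeriodic.sum_tsum_comm (hL : 0 < L) {y : ℤ × ℤ → Plane} (hy : IsPeriodic L y)
    {S T : Set (ℤ × ℤ)} (hS : IsPeriodicSet L S) (hT : IsPeriodicSet L T)
    (sS sT : Finset (Fin L × Fin L)) (hsS : ∀ c, c ∈ sS ↔ cellPoint c ∈ S)
    (hsT : ∀ c, c ∈ sT ↔ cellPoint c ∈ T) {W : ℝ → ℝ}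
    (hW : ∀ p : Plane, Summable fun k => W (dist p (y k))) :
    ∑ c ∈ sS, ∑' k' : T, W (dist (y (cellPoint c)) (y k')) =
      ∑ c ∈ sT, ∑' k : S, W (dist (y (cellPoint c)) (y k)) := by
  have hrow : ∀ (U : Set (ℤ × ℤ)), IsPeriodicSet L U → ∀ (sU : Finset (Fin L × Fin L)),
      (∀ c, c ∈ sU ↔ cellPoint c ∈ U) → ∀ (c : Fin L × Fin L),
      ∑' k' : U, W (dist (y (cellPoint c)) (y k')) =
        ∑ c' ∈ sU, ∑' g : ℤ × ℤ,
          W (dist (y (cellPoint c)) (y (cellPoint c') + (L : ℝ) • triPoint g)) := by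
    intro U hU sU hsU c
    rw [hU.tsum_eq_sum_tsum hL sU hsU (hW (y (cellPoint c)))]
    refine Finset.sum_congr rfl fun c' _ => tsum_congr fun g => ?_
    rw [hy.apply_add_zsmul]
  rw [Finset.sum_congr rfl fun c _ => hrow T hT sT hsT c,
    Finset.sum_congr rfl fun c _ => hrow S hS sS hsS c, Finset.sum_comm]
  refine Finset.sum_congr rfl fun c' _ => Finset.sum_congr rfl fun c _ => ?_
  rw [← (Equiv.neg (ℤ × ℤ)).tsum_eq]
  refine tsum_congr fun g => ?_
  rw [Equiv.neg_apply, map_neg, smul_neg, dist_eq_norm, dist_eq_norm, ← norm_neg]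
  congr 1
  abel

end Cosets

/-! ### Counting with weights over grid cells (finite families of any index type) -/

section CellsFinset

/-- `sum_cellWeight_le` of `Theil2006MinimumDistance.lean` for a finite family of points indexed
by any type: if every closed disc of radius `ρ` contains at most `M` of the points `y k`, `k ∈ u`,
and `f ≥ 0` is a weight on cell labels all of whose finite partial sums are `≤ F`, then
`∑_{k ∈ u} f(cell(y k)) ≤ F · M`. [cite: Theil2006, §2.2 proof of Lemma 2.2] -/
theorem sum_cellWeight_le_finset {ι : Type*} (u : Finset ι) (y : ι → Plane) (η : Plane) {ρ : ℝ}
    (hρ : 0 < ρ) {M : ℕ} (hM : ∀ z : Plane, (u.filter fun k => dist (y k) z ≤ ρ).card ≤ M)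
    {f : ℤ × ℤ → ℝ} (hf : ∀ c, 0 ≤ f c) {F : ℝ} (hF : ∀ t : Finset (ℤ × ℤ), ∑ c ∈ t, f c ≤ F) :
    ∑ k ∈ u, f (⌊(y k 0 - η 0) / ρ⌋, ⌊(y k 1 - η 1) / ρ⌋) ≤ F * M := by
  classical
  set g : ι → ℤ × ℤ := fun k => (⌊(y k 0 - η 0) / ρ⌋, ⌊(y k 1 - η 1) / ρ⌋) with hg
  change ∑ k ∈ u, f (g k) ≤ F * M
  rw [Finset.sum_comp f g]
  have hfib : ∀ c : ℤ × ℤ, ((u.filter fun k => g k = c).card : ℝ) ≤ M := by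
    intro c
    have hsub : (u.filter fun k => g k = c) ⊆
        u.filter fun k => dist (y k)
          !₂[η 0 + ρ * (c.1 + 1 / 2), η 1 + ρ * (c.2 + 1 / 2)] ≤ ρ := by
      intro k hk
      rw [Finset.mem_filter] at hk ⊢
      refine ⟨hk.1, ?_⟩
      obtain ⟨-, hk⟩ := hk
      subst hk
      exact dist_cellCentre_le η (y k) hρ
    exact_mod_cast (Finset.card_le_card hsub).trans (hM _)
  calc ∑ c ∈ u.image g, (u.filter fun k => g k = c).card • f c
      ≤ ∑ c ∈ u.image g, (M : ℝ) * f c := Finset.sum_le_sum fun c _ => by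
          rw [nsmul_eq_mul]
          exact mul_le_mul_of_nonneg_right (hfib c) (hf c)
    _ = M * ∑ c ∈ u.image g, f c := by rw [Finset.mul_sum]
    _ ≤ M * F := mul_le_mul_of_nonneg_left (hF _) (Nat.cast_nonneg _)
    _ = F * M := by ring

end CellsFinset

/-! ### Lemma 3.1: the minimum distance in relaxed periodic minimizers -/

section MainProof

variable {α : ℝ} {V : ℝ → ℝ} {L : ℕ} {X : Set (ℤ × ℤ)} {y : ℤ × ℤ → Plane}

/-- **Theil 2006, Lemma 3.1, with the explicit threshold `α₀ = 1/13447168`** (the threshold of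
`Theil2006_minimumDistance_holds`): for `0 < α < α₀`, `L ≥ 1`, an admissible `V` and a minimizer
`(X, y)` of the relaxed periodic energy `E_L^per(·, ·)` over `L`-periodic sets `X ⊂ A₂` and
`L`-periodic configurations, any two particles of `X` are at distance `> 1 - α` (13).

Proof (Theil 2006, p. 13, "Let `M` and `𝒜` be defined as in the proof of Lemma 2.2. In the
periodic situation we have to take the interaction between the particles in `𝒜` and the mirror
images into account …"): `M` = the maximal number of particles of `X` in a closed disc of radius
`ρ = (1-α)/2` (finite: `y` is periodic; `≤ L²`: two particles of one coset are `≥ L` apart),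
attained at `η₀`, `𝒜 = X ∩ y⁻¹ B(η₀, ρ)`; a pair at distance `≤ 1-α` gives `M ≥ 2`. The competitor
removes the `L`-periodic set `P = 𝒜 + L A₂` from `X` (same `y`). In the ordered form of the energy,
`E(X) - E(X ∖ P) = ∑_{x ∈ (X∖P) ∩ LU} ∑_{x' ∈ P} e + ∑_{x ∈ P ∩ LU} ∑_{x' ∈ X∖P} e
+ ∑_{x ∈ P ∩ LU} ∑_{x' ∈ P∖{x}} e`, and the first two sums are equal
(`IsPeriodic.sum_tsum_comm`). `P ∩ LU` has exactly `M` points, each the translate `x = a + Lg` of a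
point of `𝒜`, lying in the translated maximal disc `B(η₀ + Lξ_g, ρ) ⊇ y(𝒜 + Lg)`: its `M - 1`
companions cost `≥ 1/α` each by (2), and every row `∑_{x' ∈ T} e({x, x'})`, `T ⊆ X`, is
`≥ -W M` (`W = 4 K₀`) by the cell count of Lemma 2.2 (`IsAdmissible.neg_cellWeight_le`: (11) near,
(12) far — this covers the mirror images `(𝒜 + L A₂) ∖ 𝒜` as well — and at most `M` particles
per cell, `sum_cellWeight_le_finset`). Minimality gives `0 ≥ M(M-1)/α - 3 W M²`, impossible for
`M ≥ 2` and `α < 1/(6W)`. [cite: Theil2006, §3 Lemma 3.1 (preprint p. 13)] -/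
theorem lt_dist_of_isMinimizer_relaxedPeriodicEnergy (hα : 0 < α) (hαlt : α < 1 / 13447168)
    (hV : IsAdmissible α V) (hL : 0 < L) (hX : IsPeriodicSet L X) (hy : IsPeriodic L y)
    (hmin : ∀ (X' : Set (ℤ × ℤ)) (y' : ℤ × ℤ → Plane), IsPeriodicSet L X' → IsPeriodic L y' →
      relaxedPeriodicEnergy V L X y ≤ relaxedPeriodicEnergy V L X' y')
    {x₁ x₂ : ℤ × ℤ} (hx₁ : x₁ ∈ X) (hx₂ : x₂ ∈ X) (hne : x₁ ≠ x₂) :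
    1 - α < dist (y x₁) (y x₂) := by
  classical
  by_contra hcon
  rw [not_lt] at hcon
  have hα5 : α ≤ 1 / 5 := by linarith
  set ρ := (1 - α) / 2 with hρdef
  have hρ25 : 2 / 5 ≤ ρ := by rw [hρdef]; linarith
  have hρ0 : 0 < ρ := by linarith
  -- summable rows
  have hsumm : ∀ p : Plane, Summable fun k => V (dist p (y k)) :=
    fun p => hV.summable_periodic hL hy p
  -- the particles of `X` in a closed disc of radius `ρ`: finite sets
  have hfin : ∀ η : Plane, ({k : ℤ × ℤ | k ∈ X ∧ dist (y k) η ≤ ρ}).Finite := fun η =>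
    (hy.finite_dist_le hL η ρ).subset fun k hk => hk.2
  have hmemD : ∀ η k, k ∈ (hfin η).toFinset ↔ k ∈ X ∧ dist (y k) η ≤ ρ := fun η k =>
    Set.Finite.mem_toFinset _
  set cnt : Plane → ℕ := fun η => (hfin η).toFinset.card with hcnt
  -- two particles of one disc are at distance `≤ 1 - α`
  have hdisc : ∀ (η : Plane) (k k' : ℤ × ℤ), dist (y k) η ≤ ρ → dist (y k') η ≤ ρ →
      dist (y k) (y k') ≤ 1 - α := by
    intro η k k' hk hk'
    have := dist_triangle (y k) η (y k')
    rw [dist_comm η] at this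
    rw [hρdef] at hk hk'
    linarith
  -- two particles of one coset of `L A₂` are never in one disc: residues are injective on discs
  have hres : ∀ (η : Plane) (k k' : ℤ × ℤ), dist (y k) η ≤ ρ → dist (y k') η ≤ ρ →
      ((cellEquiv hL).symm k).1 = ((cellEquiv hL).symm k').1 → k = k' := by
    intro η k k' hk hk' hkk'
    have ek := cellEquiv_symm_apply_spec hL k
    have ek' := cellEquiv_symm_apply_spec hL k'
    set g := ((cellEquiv hL).symm k).2
    set g' := ((cellEquiv hL).symm k').2
    have hk'k : k' = k + (L : ℤ) • (g' - g) := by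
      rw [smul_sub, ← ek', ← hkk']
      conv_rhs => rw [← ek]
      abel
    by_contra hne'
    have hgg : g' - g ≠ 0 := by
      intro h0
      rw [h0, smul_zero, add_zero] at hk'k
      exact hne' hk'k.symm
    have h1 := hy.one_le_dist_add_zsmul hL k hgg
    rw [← hk'k] at h1
    have h2 := hdisc η k k' hk hk'
    linarith
  have hbdd : ∀ η, cnt η ≤ L ^ 2 := by
    intro η
    have h := Finset.card_le_card_of_injOn (s := (hfin η).toFinset)
      (t := (Finset.univ : Finset (Fin L × Fin L))) (fun k => ((cellEquiv hL).symm k).1)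
      (fun _ _ => Finset.mem_coe.2 (Finset.mem_univ _)) fun k hk k' hk' hkk' =>
        hres η k k' ((hmemD η k).1 (Finset.mem_coe.1 hk)).2
          ((hmemD η k').1 (Finset.mem_coe.1 hk')).2 hkk'
    simpa [Finset.card_univ, Fintype.card_prod, Fintype.card_fin, sq] using h
  -- the maximal count `M`, attained at `η₀`
  have hBdd : BddAbove (Set.range cnt) := ⟨L ^ 2, by rintro _ ⟨η, rfl⟩; exact hbdd η⟩
  set M := sSup (Set.range cnt) with hMdef
  have hle : ∀ η, cnt η ≤ M := fun η => le_csSup hBdd ⟨η, rfl⟩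
  obtain ⟨η₀, hη₀⟩ : ∃ η₀, cnt η₀ = M := Nat.sSup_mem (s := Set.range cnt) ⟨cnt 0, 0, rfl⟩ hBdd
  -- the close pair forces `M ≥ 2`
  have hM2 : 2 ≤ M := by
    set m : Plane := (2 : ℝ)⁻¹ • (y x₁ + y x₂) with hm
    have hd1 : dist (y x₁) m ≤ ρ := by
      have e : y x₁ - m = (2 : ℝ)⁻¹ • (y x₁ - y x₂) := by rw [hm]; module
      rw [dist_eq_norm, e, norm_smul, Real.norm_eq_abs, abs_of_pos (by norm_num), ← dist_eq_norm]
      rw [hρdef]; linarith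
    have hd2 : dist (y x₂) m ≤ ρ := by
      have e : y x₂ - m = (2 : ℝ)⁻¹ • (y x₂ - y x₁) := by rw [hm]; module
      rw [dist_eq_norm, e, norm_smul, Real.norm_eq_abs, abs_of_pos (by norm_num), ← dist_eq_norm,
        dist_comm]
      rw [hρdef]; linarith
    have hsub : ({x₁, x₂} : Finset (ℤ × ℤ)) ⊆ (hfin m).toFinset := by
      intro k hk
      rw [Finset.mem_insert, Finset.mem_singleton] at hk
      rw [hmemD]
      rcases hk with rfl | rfl
      · exact ⟨hx₁, hd1⟩
      · exact ⟨hx₂, hd2⟩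
    have := Finset.card_le_card hsub
    rw [Finset.card_pair hne] at this
    exact this.trans (hle m)
  have hMpos : 0 < M := by omega
  -- the cluster `𝒜` and the removed periodic set `P = 𝒜 + L A₂`
  set A : Finset (ℤ × ℤ) := (hfin η₀).toFinset with hA
  have hAmem : ∀ k, k ∈ A ↔ k ∈ X ∧ dist (y k) η₀ ≤ ρ := hmemD η₀
  have hAcard : A.card = M := hη₀
  set P : Set (ℤ × ℤ) := {k | ∃ a ∈ A, ∃ g : ℤ × ℤ, k = a + (L : ℤ) • g} with hP
  have hPper : IsPeriodicSet L P := by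
    rintro k ⟨a, ha, g, rfl⟩ g'
    exact ⟨a, ha, g + g', by rw [smul_add, add_assoc]⟩
  have hPX : P ⊆ X := by
    rintro k ⟨a, ha, g, rfl⟩
    exact hX a ((hAmem a).1 ha).1 g
  set X' : Set (ℤ × ℤ) := X \ P with hX'
  have hX'per : IsPeriodicSet L X' := hX.diff hPper
  have hX'X : X' ⊆ X := fun k hk => hk.1
  -- cell representatives
  set sX : Finset (Fin L × Fin L) := Finset.univ.filter fun c => cellPoint c ∈ X with hsX
  set sX' : Finset (Fin L × Fin L) := Finset.univ.filter fun c => cellPoint c ∈ X' with hsX'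
  set sP : Finset (Fin L × Fin L) := Finset.univ.filter fun c => cellPoint c ∈ P with hsP
  have hmsX : ∀ c, c ∈ sX ↔ cellPoint c ∈ X := fun c => by simp [hsX]
  have hmsX' : ∀ c, c ∈ sX' ↔ cellPoint c ∈ X' := fun c => by simp [hsX']
  have hmsP : ∀ c, c ∈ sP ↔ cellPoint c ∈ P := fun c => by simp [hsP]
  -- `P ∩ LU` = the residues of `𝒜`, `M` of them
  have hsP_eq : sP = A.image fun a => ((cellEquiv hL).symm a).1 := by
    ext c
    rw [hmsP, Finset.mem_image]
    constructor
    · rintro ⟨a, ha, g, hag⟩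
      refine ⟨a, ha, ?_⟩
      have : a = cellPoint c + (L : ℤ) • (-g) := by rw [smul_neg, hag]; abel
      rw [this, cellEquiv_symm_cellPoint_add]
    · rintro ⟨a, ha, hac⟩
      set q := ((cellEquiv hL).symm a).2 with hq
      refine ⟨a, ha, -q, ?_⟩
      have ea : cellPoint c + (L : ℤ) • q = a := by
        have := cellEquiv_symm_apply_spec hL a
        rwa [hac] at this
      rw [← ea, smul_neg, add_neg_cancel_right]
  have hsPcard : sP.card = M := by
    rw [hsP_eq, Finset.card_image_of_injOn, hAcard]
    intro a ha a' ha' h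
    exact hres η₀ a a' ((hAmem a).1 (Finset.mem_coe.1 ha)).2
      ((hAmem a').1 (Finset.mem_coe.1 ha')).2 h
  -- rows
  set R : Set (ℤ × ℤ) → ℤ × ℤ → ℝ := fun T k =>
    ∑' k' : ({k' : ℤ × ℤ | k' ∈ T ∧ k' ≠ k} : Set (ℤ × ℤ)), V (dist (y k) (y k')) with hR
  set Q : Set (ℤ × ℤ) → ℤ × ℤ → ℝ := fun T k => ∑' k' : T, V (dist (y k) (y k')) with hQ
  -- the two energies
  have hEX : relaxedPeriodicEnergy V L X y = ∑ c ∈ sX, R X (cellPoint c) := by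
    rw [relaxedPeriodicEnergy, Finset.sum_indicator_eq_sum_filter]
    exact Finset.sum_congr (by ext c; simp [hmsX]) fun c _ => rfl
  have hEX' : relaxedPeriodicEnergy V L X' y = ∑ c ∈ sX', R X' (cellPoint c) := by
    rw [relaxedPeriodicEnergy, Finset.sum_indicator_eq_sum_filter]
    exact Finset.sum_congr (by ext c; simp [hmsX']) fun c _ => rfl
  -- `X ∩ LU = (X' ∩ LU) ⊔ (P ∩ LU)`
  have hsplit : ∀ F : Fin L × Fin L → ℝ, ∑ c ∈ sX, F c = ∑ c ∈ sX', F c + ∑ c ∈ sP, F c := by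
    intro F
    rw [← Finset.sum_filter_add_sum_filter_not sX fun c => cellPoint c ∈ P, add_comm]
    congr 1
    · refine Finset.sum_congr ?_ fun _ _ => rfl
      ext c
      simp only [Finset.mem_filter, hmsX, hmsX', hX', Set.mem_sdiff]
    · refine Finset.sum_congr ?_ fun _ _ => rfl
      ext c
      simp only [Finset.mem_filter, hmsX, hmsP]
      exact ⟨fun h => h.2, fun h => ⟨hPX h, h⟩⟩
  -- splitting the rows of `E(X)`
  have h1 : ∀ c ∈ sX', R X (cellPoint c) = R X' (cellPoint c) + Q P (cellPoint c) := by
    intro c hc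
    have hcX' := (hmsX' c).1 hc
    have e1 : ({k' : ℤ × ℤ | k' ∈ X ∧ k' ≠ cellPoint c} : Set (ℤ × ℤ)) =
        {k' | k' ∈ X' ∧ k' ≠ cellPoint c} ∪ P := by
      ext k'
      simp only [Set.mem_setOf_eq, Set.mem_union, hX', Set.mem_sdiff]
      constructor
      · rintro ⟨hk'X, hk'ne⟩
        by_cases hk'P : k' ∈ P
        · exact Or.inr hk'P
        · exact Or.inl ⟨⟨hk'X, hk'P⟩, hk'ne⟩
      · rintro (⟨⟨hk'X, -⟩, hk'ne⟩ | hk'P)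
        · exact ⟨hk'X, hk'ne⟩
        · exact ⟨hPX hk'P, fun h => hcX'.2 (h ▸ hk'P)⟩
    have hdisj : Disjoint ({k' : ℤ × ℤ | k' ∈ X' ∧ k' ≠ cellPoint c}) P :=
      Set.disjoint_left.2 fun k' hk' hk'P => hk'.1.2 hk'P
    have step : (∑' k' : ({k' : ℤ × ℤ | k' ∈ X ∧ k' ≠ cellPoint c} : Set (ℤ × ℤ)),
        V (dist (y (cellPoint c)) (y k'))) =
        (∑' k' : ({k' : ℤ × ℤ | k' ∈ X' ∧ k' ≠ cellPoint c} : Set (ℤ × ℤ)),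
          V (dist (y (cellPoint c)) (y k'))) + ∑' k' : P, V (dist (y (cellPoint c)) (y k')) := by
      rw [tsum_congr_set_coe (fun k' => V (dist (y (cellPoint c)) (y k'))) e1]
      exact Summable.tsum_union_disjoint hdisj ((hsumm _).subtype _) ((hsumm _).subtype _)
    exact step
  have h2 : ∀ c ∈ sP, R X (cellPoint c) = Q X' (cellPoint c) + R P (cellPoint c) := by
    intro c hc
    have hcP := (hmsP c).1 hc
    have e1 : ({k' : ℤ × ℤ | k' ∈ X ∧ k' ≠ cellPoint c} : Set (ℤ × ℤ)) =
        X' ∪ {k' | k' ∈ P ∧ k' ≠ cellPoint c} := by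
      ext k'
      simp only [Set.mem_setOf_eq, Set.mem_union, hX', Set.mem_sdiff]
      constructor
      · rintro ⟨hk'X, hk'ne⟩
        by_cases hk'P : k' ∈ P
        · exact Or.inr ⟨hk'P, hk'ne⟩
        · exact Or.inl ⟨hk'X, hk'P⟩
      · rintro (⟨hk'X, hk'P⟩ | ⟨hk'P, hk'ne⟩)
        · exact ⟨hk'X, fun h => hk'P (h ▸ hcP)⟩
        · exact ⟨hPX hk'P, hk'ne⟩
    have hdisj : Disjoint X' ({k' : ℤ × ℤ | k' ∈ P ∧ k' ≠ cellPoint c}) :=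
      Set.disjoint_left.2 fun k' hk' hk'P => hk'.2 hk'P.1
    have step : (∑' k' : ({k' : ℤ × ℤ | k' ∈ X ∧ k' ≠ cellPoint c} : Set (ℤ × ℤ)),
        V (dist (y (cellPoint c)) (y k'))) =
        (∑' k' : X', V (dist (y (cellPoint c)) (y k'))) +
          ∑' k' : ({k' : ℤ × ℤ | k' ∈ P ∧ k' ≠ cellPoint c} : Set (ℤ × ℤ)),
            V (dist (y (cellPoint c)) (y k')) := by
      rw [tsum_congr_set_coe (fun k' => V (dist (y (cellPoint c)) (y k'))) e1]
      exact Summable.tsum_union_disjoint hdisj ((hsumm _).subtype _) ((hsumm _).subtype _)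
    exact step
  -- the symmetry of the mixed term
  have hsym : ∑ c ∈ sX', Q P (cellPoint c) = ∑ c ∈ sP, Q X' (cellPoint c) :=
    hy.sum_tsum_comm hL hX'per hPper sX' sP hmsX' hmsP (W := V) hsumm
  -- the energy difference
  have hdiff : relaxedPeriodicEnergy V L X y - relaxedPeriodicEnergy V L X' y =
      ∑ c ∈ sP, (2 * Q X' (cellPoint c) + R P (cellPoint c)) := by
    rw [hEX, hEX', hsplit, Finset.sum_congr rfl h1, Finset.sum_congr rfl h2,
      Finset.sum_add_distrib, hsym, Finset.sum_add_distrib, Finset.sum_add_distrib,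
      ← Finset.mul_sum]
    ring
  have hmin' : ∑ c ∈ sP, (2 * Q X' (cellPoint c) + R P (cellPoint c)) ≤ 0 := by
    rw [← hdiff, sub_nonpos]
    exact hmin X' y hX'per hy
  -- the cell weights and the uniform row bound `≥ -W M`
  set wt : ℤ → ℝ := fun n => ((((n.natAbs : ℕ) : ℝ) + 1) * (((n.natAbs : ℕ) : ℝ) + 2))⁻¹ with hwt
  have hrow : ∀ (x : ℤ × ℤ) (η : Plane), dist (y x) η ≤ ρ → ∀ T : Set (ℤ × ℤ), T ⊆ X →
      -(4 * 420224 * (M : ℝ)) ≤ ∑' k' : T, V (dist (y x) (y k')) := by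
    intro x η hxη T hTX
    have hs : Summable fun k' : T => V (dist (y x) (y k')) := (hsumm (y x)).subtype _
    have hneg : ∑' k' : T, -V (dist (y x) (y k')) ≤ 4 * 420224 * (M : ℝ) := by
      refine hs.neg.tsum_le_of_sum_le fun u => ?_
      have hterm : ∀ k' ∈ u, -V (dist (y x) (y (k' : ℤ × ℤ))) ≤
          420224 * (wt ⌊(y k' 0 - η 0) / ρ⌋ * wt ⌊(y k' 1 - η 1) / ρ⌋) := by
        intro k' _
        have := hV.neg_cellWeight_le hα hα5 hρ25 η (y x) (y k') hxη
        simp only [hwt]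
        linarith
      refine (Finset.sum_le_sum hterm).trans ?_
      rw [← Finset.mul_sum]
      have hMu : ∀ z : Plane, (u.filter fun k' : T => dist (y k') z ≤ ρ).card ≤ M := by
        intro z
        refine le_trans ?_ (hle z)
        refine Finset.card_le_card_of_injOn (fun k' : T => (k' : ℤ × ℤ)) ?_
          (Subtype.val_injective.injOn)
        intro k' hk'
        rw [Finset.mem_coe, Finset.mem_filter] at hk'
        rw [Finset.mem_coe, hmemD]
        exact ⟨hTX k'.2, hk'.2⟩
      have h := sum_cellWeight_le_finset u (fun k' : T => y k') η hρ0 (M := M) hMu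
        (f := fun c : ℤ × ℤ => wt c.1 * wt c.2) (fun c => by positivity) (F := 4)
        (fun t => by simpa [hwt] using sum_prod_inv_natAbs_le_four t)
      nlinarith
    rw [tsum_neg] at hneg
    linarith
  -- the two lower bounds on the rows of `P ∩ LU`
  have hQlb : ∀ c ∈ sP, -(4 * 420224 * (M : ℝ)) ≤ Q X' (cellPoint c) := by
    intro c hc
    obtain ⟨a, ha, g₀, hag⟩ := (hmsP c).1 hc
    have hya : y (cellPoint c) = y a + (L : ℝ) • triPoint g₀ := by rw [hag, hy.apply_add_zsmul]
    have hd : dist (y (cellPoint c)) (η₀ + (L : ℝ) • triPoint g₀) ≤ ρ := by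
      rw [hya, dist_add_right]
      exact ((hAmem a).1 ha).2
    exact hrow (cellPoint c) _ hd X' hX'X
  have hRlb : ∀ c ∈ sP, ((M : ℝ) - 1) * (1 / α) - 4 * 420224 * (M : ℝ) ≤ R P (cellPoint c) := by
    intro c hc
    obtain ⟨a, ha, g₀, hag⟩ := (hmsP c).1 hc
    set η : Plane := η₀ + (L : ℝ) • triPoint g₀ with hη
    -- the translated cluster `𝒜 + L g₀`
    set Ag : Finset (ℤ × ℤ) := A.image fun a' => a' + (L : ℤ) • g₀ with hAg
    have hAgcard : Ag.card = M := by
      rw [hAg, Finset.card_image_of_injective _ (add_left_injective _), hAcard]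
    have hAgP : ∀ k' ∈ Ag, k' ∈ P := by
      intro k' hk'
      obtain ⟨a', ha', rfl⟩ := Finset.mem_image.1 hk'
      exact ⟨a', ha', g₀, rfl⟩
    have hAgd : ∀ k' ∈ Ag, dist (y k') η ≤ ρ := by
      intro k' hk'
      obtain ⟨a', ha', rfl⟩ := Finset.mem_image.1 hk'
      rw [hy.apply_add_zsmul, hη, dist_add_right]
      exact ((hAmem a').1 ha').2
    have hcAg : cellPoint c ∈ Ag := Finset.mem_image.2 ⟨a, ha, hag.symm⟩
    have hcd : dist (y (cellPoint c)) η ≤ ρ := hAgd _ hcAg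
    -- split the row over `P ∖ {x}` into the companions and the rest
    have e1 : ({k' : ℤ × ℤ | k' ∈ P ∧ k' ≠ cellPoint c} : Set (ℤ × ℤ)) =
        ↑(Ag.erase (cellPoint c)) ∪ {k' | k' ∈ P ∧ k' ∉ Ag} := by
      ext k'
      simp only [Set.mem_setOf_eq, Set.mem_union, Finset.coe_erase, Set.mem_sdiff,
        Finset.mem_coe, Set.mem_singleton_iff]
      constructor
      · rintro ⟨hk'P, hk'ne⟩
        by_cases hk'A : k' ∈ Ag
        · exact Or.inl ⟨hk'A, hk'ne⟩
        · exact Or.inr ⟨hk'P, hk'A⟩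
      · rintro (⟨hk'A, hk'ne⟩ | ⟨hk'P, hk'A⟩)
        · exact ⟨hAgP k' hk'A, hk'ne⟩
        · exact ⟨hk'P, fun h => hk'A (h ▸ hcAg)⟩
    have hdisj : Disjoint (↑(Ag.erase (cellPoint c)) : Set (ℤ × ℤ)) {k' | k' ∈ P ∧ k' ∉ Ag} :=
      Set.disjoint_left.2 fun k' hk' hk'' =>
        hk''.2 (Finset.mem_erase.1 (Finset.mem_coe.1 hk')).2
    have hsplitR : R P (cellPoint c) =
        ∑ k' ∈ Ag.erase (cellPoint c), V (dist (y (cellPoint c)) (y k')) +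
          ∑' k' : ({k' : ℤ × ℤ | k' ∈ P ∧ k' ∉ Ag} : Set (ℤ × ℤ)),
            V (dist (y (cellPoint c)) (y k')) := by
      have step : (∑' k' : ({k' : ℤ × ℤ | k' ∈ P ∧ k' ≠ cellPoint c} : Set (ℤ × ℤ)),
          V (dist (y (cellPoint c)) (y k'))) =
          (∑' k' : (↑(Ag.erase (cellPoint c)) : Set (ℤ × ℤ)), V (dist (y (cellPoint c)) (y k'))) +
            ∑' k' : ({k' : ℤ × ℤ | k' ∈ P ∧ k' ∉ Ag} : Set (ℤ × ℤ)),
              V (dist (y (cellPoint c)) (y k')) := by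
        rw [tsum_congr_set_coe (fun k' => V (dist (y (cellPoint c)) (y k'))) e1]
        exact Summable.tsum_union_disjoint hdisj ((hsumm _).subtype _) ((hsumm _).subtype _)
      rw [Finset.tsum_subtype' (Ag.erase (cellPoint c))
        (fun k' => V (dist (y (cellPoint c)) (y k')))] at step
      exact step
    -- the companions: `M - 1` bonds of length `≤ 1 - α`, each `≥ 1/α` by (2)
    have hcomp : ((M : ℝ) - 1) * (1 / α) ≤
        ∑ k' ∈ Ag.erase (cellPoint c), V (dist (y (cellPoint c)) (y k')) := by
      have hcard : ((Ag.erase (cellPoint c)).card : ℝ) = M - 1 := by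
        rw [Finset.card_erase_of_mem hcAg, hAgcard, Nat.cast_sub (by omega), Nat.cast_one]
      have h := Finset.card_nsmul_le_sum (Ag.erase (cellPoint c))
        (fun k' => V (dist (y (cellPoint c)) (y k'))) (1 / α) fun k' hk' => by
          have hk'A := (Finset.mem_erase.1 hk').2
          exact hV.core _ ⟨dist_nonneg, hdisc η _ _ hcd (hAgd k' hk'A)⟩
      rw [nsmul_eq_mul, hcard] at h
      exact h
    have hrest := hrow (cellPoint c) η hcd {k' | k' ∈ P ∧ k' ∉ Ag} fun k' hk' => hPX hk'.1
    rw [hsplitR]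
    linarith
  -- the final count
  have hsum_lb : ∑ c ∈ sP, (2 * (-(4 * 420224 * (M : ℝ))) +
      (((M : ℝ) - 1) * (1 / α) - 4 * 420224 * (M : ℝ))) ≤
      ∑ c ∈ sP, (2 * Q X' (cellPoint c) + R P (cellPoint c)) :=
    Finset.sum_le_sum fun c hc => by linarith [hQlb c hc, hRlb c hc]
  rw [Finset.sum_const, hsPcard, nsmul_eq_mul] at hsum_lb
  have hM2r : (2 : ℝ) ≤ M := by exact_mod_cast hM2
  have key : (M : ℝ) * (((M : ℝ) - 1) * (1 / α) - 3 * (4 * 420224 * (M : ℝ))) ≤ 0 := by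
    linarith
  have key2 : ((M : ℝ) - 1) * (1 / α) ≤ 3 * (4 * 420224 * (M : ℝ)) := by
    by_contra h
    rw [not_le] at h
    have : 0 < (M : ℝ) * (((M : ℝ) - 1) * (1 / α) - 3 * (4 * 420224 * (M : ℝ))) :=
      mul_pos (by linarith) (by linarith)
    linarith
  have key3 : ((M : ℝ) - 1) ≤ α * (3 * (4 * 420224 * (M : ℝ))) := by
    have := mul_le_mul_of_nonneg_left key2 hα.le
    rw [← mul_assoc, mul_comm α, mul_assoc, mul_one_div_cancel hα.ne', mul_one] at this
    linarith
  nlinarith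

/-- **Theil 2006, Lemma 3.1** (the periodic version of Lemma 2.2 (13), §3, preprint p. 13):
"There exists `α₀ ∈ (0, ½)` such that for all `α ∈ (0, α₀)`, `L ∈ ℕ` and all minimizers
`(X_min, y_min)` of `E_L^per(·, ·)` the minimum distance between the particles satisfies estimate
(13)" [`min_{x ≠ x'} |y(x) - y(x')| > 1 - α`]. Here `E_L^per(X, {y})` is the relaxed periodic
energy `relaxedPeriodicEnergy V L X y` over `L`-periodic sets `X ⊂ A₂` (`IsPeriodicSet`) and
`L`-periodic configurations `y ∈ Y_L^per` (`IsPeriodic`), `L ≥ 1`, `V` satisfying (1)–(5)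
(`IsAdmissible α V`, real-valued), and a minimizer is a pair `(X, y)` of least energy among all
such pairs. PROVED (`lt_dist_of_isMinimizer_relaxedPeriodicEnergy`, `α₀ = 1/13447168`). This is
the ingredient of the proof of Theorem 1.2 (p. 14) that, together with (44), makes the image of a
periodic ground state satisfy (42). [cite: Theil2006, §3 Lemma 3.1 (preprint p. 13)] -/
theorem periodicMinimumDistance :
    ∃ α₀ : ℝ, 0 < α₀ ∧ α₀ < 1 / 2 ∧ ∀ α : ℝ, 0 < α → α < α₀ → ∀ L : ℕ, 0 < L →
      ∀ V : ℝ → ℝ, IsAdmissible α V → ∀ (X : Set (ℤ × ℤ)) (y : ℤ × ℤ → Plane),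
        IsPeriodicSet L X → IsPeriodic L y →
        (∀ (X' : Set (ℤ × ℤ)) (y' : ℤ × ℤ → Plane), IsPeriodicSet L X' → IsPeriodic L y' →
            relaxedPeriodicEnergy V L X y ≤ relaxedPeriodicEnergy V L X' y') →
          ∀ x ∈ X, ∀ x' ∈ X, x ≠ x' → 1 - α < dist (y x) (y x') :=
  ⟨1 / 13447168, by norm_num, by norm_num, fun _α hα hαlt _L hL _V hV _X _y hX hy hmin _x hx
    _x' hx' hne => lt_dist_of_isMinimizer_relaxedPeriodicEnergy hα hαlt hV hL hX hy hmin hx hx' hne⟩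

end MainProof

end Theil2006

end Literature.MathematicalPhysics.StatisticalMechanics

end
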